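import Summits.ABC.IUTFork.Thm311RealDegree
import Literature.IUT.LogVolume.PacketLogShellVolumeGaloisDescent
import HarnessLib

/-!
# [IUTchIII] Cor. 3.12 at the REAL settings over a number field `K`: the `V(K)`-indexed Θ-side summands descend
# to the section `V̲ ≅ V_mod` — the re-indexing `Fibre ≃ V(K)_p` + Galois descent, in c312-5's presentation currency

Record-only file (D-0012) of the abc-iut cell (seat abc-iut-w5-d056); TAKES NO SIDE. For the real instance of
[IUTchIII] Thm. 3.11 / Cor. 3.12 over a number field (abc-iut-c312-5's `thetaIndex X`, `X : PilotData K`), the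
`(j+1)`-packet summands over a prime `p` are indexed by `e : S^±_{j+1} → Fibre(V(K) → V_ℚ)_p`, weighted by
`weightPr X p j e = Π_a Pr_K(v(e a))` (`Thm311RealDegree`), with factor fields `kOf X p (e a) = RescaledCompletion K p
(v(e a))` (`Cor312VolumesRealDH`); the fibre IS `V(K)_p` (`fibreEquivPlacesOver`). The Θ-side bound of the
content-hull form (abc-iut-s2-p7's `Cor312ThetaLocalLeContentHull` / `Cor312PilotIdelesPrContentBound`:
`−|log Θ|_{i+1,p} ≤ Σ_e weightPr·(−m(e)·log p + log μ̄(hull(log_p(R^×_e))))`) is therefore a `Pr_K`-expectation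
over `V(K)_p^{j+1}`; [IUTchIV] Thm. 1.10 Step (v) (p. 28) / [IUTchI] Def. 3.1 (e), Rmk. 3.1.5 read it over the
SECTION `V̲ ≅ V_mod` with weights `[(F_mod)_v : ℚ_p]`. THIS FILE supplies that reading:

* `sum_weightPr_mul_eq_sum_placesOver` — pure re-indexing along `fibreEquivPlacesOver`:
  `Σ_e weightPr X p j e · q(v ∘ e) = Σ_{w⃗ : S^±_{j+1} → V(K)_p} (Π_a Pr_K(w⃗ a)) · q(w⃗)`;
* `sum_weightPr_mul_eq_placeSection` — for `K/F₀` GALOIS, `σ : PlaceSection F₀ K` and a summand `q` invariant under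
  the componentwise `Gal(K/F₀)^{j+1}`-action: `Σ_e weightPr X p j e · q(v ∘ e) = Σ_{v⃗ : S^±_{j+1} → V(F₀)_p}
  (Π_a Pr_{F₀}(v⃗ a)) · q(v̲⃗)` (Literature `sum_prod_weight_mul_eq_of_smul_invariant_placeSection`);
* `sum_weightPr_mul_contentHull_eq_placeSection` — the CONTENT-HULL SUMMAND: for a Galois-invariant content
  family `m`, `Σ_e weightPr·(−m·log p + log μ̄(hull(log_p(R^×_{kOf ∘ e})))) = Σ_{v⃗} Pr_{F₀}(v⃗)·(−m(v̲⃗)·log p +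
  log μ̄(hull(log_p(R^×_{K_{v̲⃗}}))))` with `K_{v̲} = RescaledCompletion K p (σ.lift v)` = S2's
  `(σ.localFields p).k v` ON THE NOSE (Literature `sum_prod_weight_mul_add_logPacketHullVolume_eq`; the Galois
  invariance of the hull volume is `packetLogμ_packetHull_logPacket_galois`).

[cite: Mochizuki2012, IUTchIV Thm. 1.10 proof Step (v) p. 28] [cite: Mochizuki2012, IUTchI Rmk. 3.1.5 p. 65]
[cite: DupuyHilado2025, §3.6] Classical bookkeeping about OUR typed objects; no new Prop facts; nothing here bears
on whether [IUTchIII] Thm. 3.11 licenses Cor. 3.12. Typed ≠ endorsed.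
-/

noncomputable section

namespace Summit.ABC.IUTFork.Thm311.Real

open NumberField IsDedekindDomain Literature.IUT.LogVolume Literature.NumberTheory.NumberFields Finset
open scoped Pointwise

variable {F₀ : Type} [Field F₀] [NumberField F₀] {K : Type} [Field K] [NumberField K] [Algebra F₀ K]
variable (X : PilotData K) (p : ℕ) [hp : Fact p.Prime] (j : (thetaIndex X).Label)
-- the summand index instances are taken as ARGUMENTS, so that a consumer's own choice (e.g. `Fintype.ofFinite`,
-- abc-iut-s2-p7's `Cor312PilotIdelesPrContentBound`) is the one the sums are stated with
variable [Fintype ((thetaIndex X).Caps j → (thetaIndex X).Fibre (.inr (ratPrime p)))]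

/-! ## 1. Re-indexing the packet summands by tuples of places -/

omit [NumberField F₀] [Algebra F₀ K] [Fintype ((thetaIndex X).Caps j → (thetaIndex X).Fibre (.inr (ratPrime p)))] in
/-- The underlying place of a fibre element IS the first component of `fibreEquivPlacesOver` (definitional).
[cite: DupuyHilado2025, §3.6] -/
theorem placeOf_eq_fibreEquivPlacesOver (x : (thetaIndex X).Fibre (.inr (ratPrime p))) :
    placeOf X p x = (fibreEquivPlacesOver X (ratPrime p) x).1 := rfl

omit [NumberField F₀] [Algebra F₀ K] in
/-- **Re-indexing**: a `weightPr`-weighted sum over the summand index `e : S^±_{j+1} → Fibre_p` of a quantity read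
on the underlying tuple of places is the `Π Pr_K`-weighted sum over `w⃗ : S^±_{j+1} → V(K)_p`.
[cite: DupuyHilado2025, §3.6] -/
theorem sum_weightPr_mul_eq_sum_placesOver (q : ((thetaIndex X).Caps j → placesOver K p) → ℝ) :
    ∑ e : (thetaIndex X).Caps j → (thetaIndex X).Fibre (.inr (ratPrime p)),
        weightPr X p j e * q (fun a => fibreEquivPlacesOver X (ratPrime p) (e a)) =
      ∑ w : (thetaIndex X).Caps j → placesOver K p, (∏ a, weight K (w a).1) * q w :=
  Fintype.sum_equiv (Equiv.piCongrRight fun _ => fibreEquivPlacesOver X (ratPrime p))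
    (fun e => weightPr X p j e * q (fun a => fibreEquivPlacesOver X (ratPrime p) (e a)))
    (fun w => (∏ a, weight K (w a).1) * q w) fun e => by rfl

/-! ## 2. Galois descent to the section -/

/-- **Galois descent of the packet summands to the section `V̲`**: for `K/F₀` Galois, `σ : PlaceSection F₀ K` and
a summand `q` on tuples of places of `K` over `p` invariant under the componentwise action of `Gal(K/F₀)^{j+1}`,
`Σ_e weightPr X p j e · q(v ∘ e) = Σ_{v⃗ : S^±_{j+1} → V(F₀)_p} (Π_a Pr_{F₀}(v⃗ a)) · q(v̲⃗)`.
[cite: Mochizuki2012, IUTchIV Thm. 1.10 proof Step (v) p. 28] [cite: Mochizuki2012, IUTchI Rmk. 3.1.5 p. 65] -/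
theorem sum_weightPr_mul_eq_placeSection [IsGalois F₀ K] (σ : PlaceSection F₀ K)
    (q : ((thetaIndex X).Caps j → placesOver K p) → ℝ)
    (hq : ∀ (g : (thetaIndex X).Caps j → (K ≃ₐ[F₀] K)) (w : (thetaIndex X).Caps j → placesOver K p),
      q (fun a => ⟨g a • (w a).1, smul_mem_placesOver F₀ K (g a) (w a).2⟩) = q w) :
    ∑ e : (thetaIndex X).Caps j → (thetaIndex X).Fibre (.inr (ratPrime p)),
        weightPr X p j e * q (fun a => fibreEquivPlacesOver X (ratPrime p) (e a)) =
      ∑ v : (thetaIndex X).Caps j → placesOver F₀ p, (∏ a, weight F₀ (v a).1) *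
        q (fun a => ⟨σ.lift (v a).1, σ.lift_mem_placesOver (v a)⟩) := by
  rw [sum_weightPr_mul_eq_sum_placesOver]
  exact sum_prod_weight_mul_eq_of_smul_invariant_placeSection F₀ K σ q hq

/-! ## 3. The content-hull summand -/

/-- **Descent of the CONTENT-HULL summands** (the shape of abc-iut-s2-p7's Θ-side bound): for `K/F₀` Galois,
`σ : PlaceSection F₀ K` and a content family `m` on tuples of places of `K` over `p` invariant under the componentwise
`Gal(K/F₀)^{j+1}`-action,
`Σ_e weightPr X p j e · (−m(v∘e)·log p + log μ̄(hull(log_p(R^×_{kOf ∘ e})))) =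
 Σ_{v⃗ : S^±_{j+1} → V(F₀)_p} (Π_a Pr_{F₀}(v⃗ a)) · (−m(v̲⃗)·log p + log μ̄(hull(log_p(R^×_{(K_{v̲_a})_a}))))`,
the right-hand packets being those of S2's genuine completions `K_{v̲} = RescaledCompletion K p (σ.lift v)`.
[cite: Mochizuki2012, IUTchIV Thm. 1.10 proof Step (v) p. 28] [cite: Mochizuki2012, IUTchI Rmk. 3.1.5 p. 65] -/
theorem sum_weightPr_mul_contentHull_eq_placeSection [IsGalois F₀ K] (σ : PlaceSection F₀ K)
    (m : ((thetaIndex X).Caps j → placesOver K p) → ℤ)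
    (hm : ∀ (g : (thetaIndex X).Caps j → (K ≃ₐ[F₀] K)) (w : (thetaIndex X).Caps j → placesOver K p),
      m (fun a => ⟨g a • (w a).1, smul_mem_placesOver F₀ K (g a) (w a).2⟩) = m w) :
    ∑ e : (thetaIndex X).Caps j → (thetaIndex X).Fibre (.inr (ratPrime p)),
        weightPr X p j e *
          (-((m (fun a => fibreEquivPlacesOver X (ratPrime p) (e a)) : ℝ) * Real.log p) +
            packetLogμ p (fun a => kOf X p (e a))
              (packetHull p (fun a => kOf X p (e a))
                (logPacket p (fun a => kOf X p (e a)) : Set (PacketAlgebra p (fun a => kOf X p (e a)))))) =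
      ∑ v : (thetaIndex X).Caps j → placesOver F₀ p, (∏ a, weight F₀ (v a).1) *
        (-((m (fun a => ⟨σ.lift (v a).1, σ.lift_mem_placesOver (v a)⟩) : ℝ) * Real.log p) +
          packetLogμ p (fun a => RescaledCompletion K p (σ.lift (v a).1)
              (natCast_mem_asIdeal_of_mem_placesOver K p (σ.lift_mem_placesOver (v a))))
            (packetHull p _ (logPacket p (fun a => RescaledCompletion K p (σ.lift (v a).1)
                (natCast_mem_asIdeal_of_mem_placesOver K p (σ.lift_mem_placesOver (v a)))) :
              Set (PacketAlgebra p (fun a => RescaledCompletion K p (σ.lift (v a).1)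
                (natCast_mem_asIdeal_of_mem_placesOver K p (σ.lift_mem_placesOver (v a)))))))) := by
  have h := sum_weightPr_mul_eq_sum_placesOver X p j
    (fun w => -((m w : ℝ) * Real.log p) +
      packetLogμ p (fun a => RescaledCompletion K p (w a).1 (natCast_mem_asIdeal_of_mem_placesOver K p (w a).2))
        (packetHull p _ (logPacket p (fun a => RescaledCompletion K p (w a).1
            (natCast_mem_asIdeal_of_mem_placesOver K p (w a).2)) :
          Set (PacketAlgebra p (fun a => RescaledCompletion K p (w a).1
            (natCast_mem_asIdeal_of_mem_placesOver K p (w a).2))))))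
  -- `kOf X p (e a)` IS `RescaledCompletion K p (v(e a))` (definitional), so `h` re-indexes the left-hand side
  refine Eq.trans (b := ∑ w : (thetaIndex X).Caps j → placesOver K p, (∏ a, weight K (w a).1) *
      (-((m w : ℝ) * Real.log p) +
        packetLogμ p (fun a => RescaledCompletion K p (w a).1 (natCast_mem_asIdeal_of_mem_placesOver K p (w a).2))
          (packetHull p _ (logPacket p (fun a => RescaledCompletion K p (w a).1
              (natCast_mem_asIdeal_of_mem_placesOver K p (w a).2)) :
            Set (PacketAlgebra p (fun a => RescaledCompletion K p (w a).1
              (natCast_mem_asIdeal_of_mem_placesOver K p (w a).2))))))) h ?_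
  exact sum_prod_weight_mul_add_logPacketHullVolume_eq F₀ K p σ (fun w => -((m w : ℝ) * Real.log p))
    (fun g w => by rw [hm g w])

end Summit.ABC.IUTFork.Thm311.Real

end
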